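import Summits.ResolutionOfSingularities.ResolutionOfSingularities.Theorems.DeltaCutStellarLow
import Summits.ResolutionOfSingularities.ResolutionOfSingularities.Theorems.DeltaCutStellarLatJLaw

/-!
# StellarCut R22b — «LowResidue»: the LOW-RESIDUE CELL `WORNCHypWildLow` CARVED from `WORNCHypWildRest4`, and ITS LAW
# `worNCHypWildLow_holds` (lens-6 «barrier-complement carving», g36 door 3; family (iii) «n = p·m» of the critic's WINDOW g37/g38)

Route `MaxContactCut`, column `E1TopNoAbs`; decomposition lineage `decomp-res-lens-6`.

After J21 (`worNCHypWildLatJ_holds`) the located residual of the wild hypersurface-shape n.c. law is `WORNCHypWildRest4 n` (J21d):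
the binders of `WORNCHypWild n` verbatim minus the jet, latent and latent-jet stages at the pure-characteristic marking `p = n`.
NOTHING was decided at the COMPOSITE markings `n = p·m`, `m ≥ 2` (T18's coprime condition is not star-stable there; g34 witness).
THIS FILE carves the remainder by ONE intrinsic frame clause and DECIDES the new cell at every marking:

* §Class — `IsNCHypStageLow p n N`: an s.n.c. hypersurface-shape frame with `SuppLE` whose labels `a` have LOW RESIDUES,
  `a = 0 ∨ (0 < a % n ∧ a % n < p)` (R22a); at `n = p` it IS T18's coprime stage (`isNCHypStageLow_self_iff_cop`), hence a jet stage
  (T19c `isNCHypStageJet_of_cop`) — so at the prime levels the new cell is subsumed by the binder `¬ (p = n ∧ IsNCHypStageJet p n _)`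
  (`worNCHypWildLow_of_prime`): ITS CONTENT IS EXACTLY THE COMPOSITE MARKINGS.
* §Cells — `WORNCHypWildLow n` (binders of `WORNCHypWildRest4 n` VERBATIM, plus a low-residue frame), `WORNCHypWildRest5 n` (the
  same binders plus `¬ IsNCHypStageLow p n`), the exact carve `worNCHypWildRest4_iff_low_rest5` (excluded middle), families.
* §Law — the bridge `exists_ncHypShapeLow_of_isNCHypStageLow` (T17b `ncHypShapeF_of_isBase` + `NCFrame.expOf_cons_expList` BY NAME),
  `worLow_holds` (frame level) and ★★ `worNCHypWildLow_holds : ∀ n, 1 ≤ n → WORNCHypWildLow n` by R22a's list law (`1 ≤ n` and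
  `p ∣ n` give the `2 ≤ n` of the safe-face round lemma); rewires `worNCHypWildRest4_iff_rest5`, `worNCHypWild_iff_rest5`, families.
* §Carve — the column's carve with the low-residue cell DISCHARGED (edges to `E1TopSHeavy`, `E1TopNoAbs`, `E1TopGHeavy`).

`WORNCHypWildRest5 n` is UNDECIDED · TYPED WITH TEST DATA: (iii-a) composite marking, a positive label of residue `0` mod `n` —
`h⁴ + u·z⁴`, `h⁴ + u·z⁴w⁴` in characteristic `2`: the `h`-chart of the face round carries `(1 + z')⁴ + (u − 1)·z'⁴`, order `4` again
at `z' = 1` when `u − 1 = t⁴` (the COMPOSITE-MARKING KANGAROO; T19/J21's jet and eigen data are typed at marking `p`) — IDEA-NEEDED;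
(iii-b) residue `≥ p`: the g34 witness `h⁴ + u·z³w³` (`(3,3) ↦ 2 ↦ (2,2)`); (i-b) «EvenLatent» and (ii) «polynomial-tail» at `p = n`
(J21d's docstring) — untouched here.  KERNEL INHABITANT of the cell at `n = 4`, `p = 2`: R22c (`DeltaCutStellarLowInhabitant`).

0 sorry; axioms standard. [new] [cite: Kollar2007, (3.111) Step 3] [cite: CossartPiltant2008, Prop. 4.2 (a)] [cite: Hauser2010, §5]
-/

noncomputable section

open CategoryTheory CategoryTheory.Limits AlgebraicGeometry TopologicalSpace IsLocalRing
open Literature.AlgebraicGeometry.Resolution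

namespace Summit.ResolutionOfSingularities.ResolutionOfSingularities.Theorems.DeltaCutClasses

open Summit.ResolutionOfSingularities.ResolutionOfSingularities.Theorems
open WeakOrderReduction ForcedTowerClasses

/-! ### §Class — the low-residue frame class -/

section Class

/-- **`IsNCHypStageLow p n N` — LOW-RESIDUE LABELLED hypersurface-shape n.c. stage**: an s.n.c. frame in the hypersurface shape with
`SuppLE` (i.e. `IsNCHypStage n N`, T1) every label `a` of which satisfies `a = 0 ∨ (0 < a % n ∧ a % n < p)`.
DEFINITION (letter · the «LowResidue» class; meaningful at every marking `p ∣ n`). [new] -/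
def IsNCHypStageLow (p n : ℕ) (N : Stage) : Prop :=
  ∃ F : NCFrame N, F.IsSNC ∧ F.HypShape n ∧ F.SuppLE n ∧ ∀ i, F.a i = 0 ∨ (0 < F.a i % n ∧ F.a i % n < p)

/-- a low-residue stage is a hypersurface-shape n.c. stage -/
theorem isNCHypStage_of_low {p n : ℕ} {N : Stage} (h : IsNCHypStageLow p n N) : IsNCHypStage n N := by
  obtain ⟨F, hS, hF, hSupp, -⟩ := h
  exact ⟨F, hS, hF, hSupp⟩

/-- **at the pure-characteristic marking a low-residue stage is a COPRIME stage (T18).** [new] -/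
theorem isNCHypStageCop_of_low_self {p : ℕ} {N : Stage} (h : IsNCHypStageLow p p N) : IsNCHypStageCop p p N := by
  obtain ⟨F, hS, hF, hSupp, hlab⟩ := h
  exact ⟨F, hS, hF, hSupp, fun i => (hlab i).imp_right fun h => not_dvd_of_mod_pos_of_mod_lt (dvd_refl p) h.1 h.2⟩

/-- ★ **AT `n = p` THE LOW-RESIDUE CLASS IS T18's COPRIME CLASS** (`p` prime). [new] -/
theorem isNCHypStageLow_self_iff_cop {p : ℕ} (hp : p.Prime) {N : Stage} : IsNCHypStageLow p p N ↔ IsNCHypStageCop p p N := by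
  refine ⟨isNCHypStageCop_of_low_self, fun h => ?_⟩
  obtain ⟨F, hS, hF, hSupp, hlab⟩ := h
  exact ⟨F, hS, hF, hSupp, fun i => (eq_zero_or_not_dvd_iff_low hp).mp (hlab i)⟩

/-- at the pure-characteristic marking a low-residue stage is a JET stage (T18 ⊆ T19: `isNCHypStageJet_of_cop`). [new] -/
theorem isNCHypStageJet_of_low_self {p : ℕ} {N : Stage} (h : IsNCHypStageLow p p N) : IsNCHypStageJet p p N :=
  isNCHypStageJet_of_cop (isNCHypStageCop_of_low_self h)

end Class

/-! ### §Cells — the low-residue cell, the new remainder, the exact carve -/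

section Cells

/-- **`WORNCHypWildLow n` — THE LOW-RESIDUE CELL**: the binders of `WORNCHypWildRest4 n` (J21d) VERBATIM, PLUS a low-residue frame
(`IsNCHypStageLow p n`; NO `p = n` guard — the class lives at every marking `p ∣ n`).  DECIDED · HOLDS (`worNCHypWildLow_holds`).
At the prime levels it is subsumed by the jet binder (`worNCHypWildLow_of_prime`); its content is the COMPOSITE markings `n = p·m`,
`m ≥ 2`.  Kernel-inhabited (R22c): `x₀⁴ + x₁⁵x₂` over `𝔽₂` at marking `4`, frame `(V(x₀); x₁ : 5, x₂ : 1)`. [new]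
[cite: Kollar2007, (3.111) Step 3] -/
def WORNCHypWildLow (n : ℕ) : Prop :=
  ∀ p : ℕ, p.Prime → ∀ (k : Type) [Field k] [CharP k p] (Y : Scheme.{0}) (g : Y ⟶ Spec (.of k)),
    IsBase Y g → p ∣ n → ∀ M : MarkedIdeal Y, IsDatum n M → IsNCHypStage n ⟨Y, M.ideal⟩ →
      ¬ (p = n ∧ IsNCHypStageJet p n ⟨Y, M.ideal⟩) → ¬ (p = n ∧ IsNCHypStageLat p ⟨Y, M.ideal⟩) →
        ¬ (p = n ∧ IsNCHypStageLatJ p ⟨Y, M.ideal⟩) → IsNCHypStageLow p n ⟨Y, M.ideal⟩ →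
          ∃ t : CentreSeq Y, WeakResolution t M

/-- **`WORNCHypWildRest5 n` — THE REMAINDER AFTER THE LOW-RESIDUE CELL**: the binders of `WORNCHypWildRest4 n` verbatim PLUS
`¬ IsNCHypStageLow p n`.  UNDECIDED · TYPED WITH TEST DATA (module docstring): (iii-a) composite marking with a positive label of
residue `0` mod `n` (`h⁴ + u·z⁴`, char `2`: the composite-marking kangaroo) — IDEA-NEEDED; (iii-b) residue `≥ p` (g34's `(3,3)` at
`n = 4`); (i-b) «EvenLatent», (ii) «polynomial-tail» at `p = n`. [new] [cite: Hauser2010, §§3–5] -/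
def WORNCHypWildRest5 (n : ℕ) : Prop :=
  ∀ p : ℕ, p.Prime → ∀ (k : Type) [Field k] [CharP k p] (Y : Scheme.{0}) (g : Y ⟶ Spec (.of k)),
    IsBase Y g → p ∣ n → ∀ M : MarkedIdeal Y, IsDatum n M → IsNCHypStage n ⟨Y, M.ideal⟩ →
      ¬ (p = n ∧ IsNCHypStageJet p n ⟨Y, M.ideal⟩) → ¬ (p = n ∧ IsNCHypStageLat p ⟨Y, M.ideal⟩) →
        ¬ (p = n ∧ IsNCHypStageLatJ p ⟨Y, M.ideal⟩) → ¬ IsNCHypStageLow p n ⟨Y, M.ideal⟩ →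
          ∃ t : CentreSeq Y, WeakResolution t M

/-- ★ **THE CARVE OF THE REMAINDER BY THE LOW-RESIDUE CLASS (exact, hyp-free, pure logic)**:
`WORNCHypWildRest4 n ⟺ WORNCHypWildLow n ∧ WORNCHypWildRest5 n`. [new] -/
theorem worNCHypWildRest4_iff_low_rest5 (n : ℕ) : WORNCHypWildRest4 n ↔ WORNCHypWildLow n ∧ WORNCHypWildRest5 n := by
  constructor
  · intro h
    exact ⟨fun p hp k _ _ Y g hB hd M hM hS hc hl hj _ => h p hp k Y g hB hd M hM hS hc hl hj,
      fun p hp k _ _ Y g hB hd M hM hS hc hl hj _ => h p hp k Y g hB hd M hM hS hc hl hj⟩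
  · rintro ⟨hL, hR⟩ p hp k _ _ Y g hB hd M hM hS hc hl hj
    by_cases hw : IsNCHypStageLow p n ⟨Y, M.ideal⟩
    · exact hL p hp k Y g hB hd M hM hS hc hl hj hw
    · exact hR p hp k Y g hB hd M hM hS hc hl hj hw

/-- the FAMILY of low-residue cells (all markings `n ≥ 1`) -/
def E1NCHypWildLow : Prop := ∀ n : ℕ, 1 ≤ n → WORNCHypWildLow n

/-- the FAMILY of new remainders (all markings `n ≥ 1`): the column's LOCATED RESIDUAL after g36 door 3. UNDECIDED · typed with test data. -/
def E1NCHypWildRest5 : Prop := ∀ n : ℕ, 1 ≤ n → WORNCHypWildRest5 n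

/-- families: `E1NCHypWildRest4 ⟺ E1NCHypWildLow ∧ E1NCHypWildRest5` (exact, pure logic). [new] -/
theorem e1NCHypWildRest4_iff_low_rest5 : E1NCHypWildRest4 ↔ E1NCHypWildLow ∧ E1NCHypWildRest5 :=
  ⟨fun h => ⟨fun n hn => ((worNCHypWildRest4_iff_low_rest5 n).mp (h n hn)).1,
    fun n hn => ((worNCHypWildRest4_iff_low_rest5 n).mp (h n hn)).2⟩,
    fun h n hn => (worNCHypWildRest4_iff_low_rest5 n).mpr ⟨h.1 n hn, h.2 n hn⟩⟩

end Cells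

/-! ### §Law — the bridge from the binders and the low-residue law -/

section Law

open AlgebraicGeometry.Scheme.IdealSheafData (vanishingIdeal)

variable {Y : Scheme.{0}}

/-- **THE BRIDGE from the binders of `WORNCHypWildLow`**: a base `n`-datum over a field of characteristic `p ∣ n`, `2 ≤ n`, whose stage
is a LOW-RESIDUE hypersurface-shape n.c. stage is a `ncHypShapeLow p n`-datum for `E := (𝓘(H), 0) :: [(𝓘(Dᵢ), aᵢ)]ᵢ`, `H := 𝓘(F.H)`
(T17b's unit-free bridge; `p = 0` in the stalks; the exponents of `E` are the labels). [new] [folklore] -/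
theorem exists_ncHypShapeLow_of_isNCHypStageLow {p : ℕ} (hp : p.Prime) {n : ℕ} (hpn : p ∣ n) (hn2 : 2 ≤ n) {k : Type} [Field k]
    [CharP k p] (g : Y ⟶ Spec (.of k)) (hB : IsBase Y g) {M : MarkedIdeal Y} (hM : IsDatum n M)
    (hNC : IsNCHypStageLow p n ⟨Y, M.ideal⟩) :
    ∃ (E : List (Y.IdealSheafData × ℕ)) (H : Y.IdealSheafData),
      HasSNC (H :: boundaryOf E) ∧ H ∈ boundaryOf E ∧ ncHypShapeLow p n Y E H M := by
  obtain ⟨F, hS, hF, hSupp, hlab⟩ := hNC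
  obtain ⟨hH, hEs, hP⟩ := ncHypShapeF_of_isBase g hB hM hS hF hSupp
  have hinj : ∀ i j, vanishingIdeal (F.D i) = vanishingIdeal (F.D j) → i = j := by
    intro i j hij
    by_contra hne
    have hset : ((F.D i : Closeds Y) : Set Y) = (F.D j : Set Y) := by
      rw [← Scheme.IdealSheafData.coe_support_vanishingIdeal (Z := F.D i), hij,
        Scheme.IdealSheafData.coe_support_vanishingIdeal]
    exact hS.2.2.2.2.2 i j hne hset.le
  refine ⟨_, _, hEs, hH, hP, hp, hpn, hn2, natCast_stalk_eq_zero_of_charP p g, fun K y _ => ?_⟩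
  rcases F.expOf_cons_expList hinj K with h0 | ⟨i, hi⟩
  · exact Or.inl h0
  · rw [hi]; exact hlab i

/-- ★★ **THE LOW-RESIDUE LAW, frame level, hyp-free**: over a field of characteristic `p ∣ n`, `n ≥ 1`, a base `n`-datum whose stage is a
LOW-RESIDUE n.c. stage admits a weak resolution — Kollár's strategy through `H` (T16) on R22a's star-stable class.
[new] [cite: Kollar2007, (3.111) Step 3] [cite: CossartPiltant2008, Prop. 4.2 (a)] -/
theorem worLow_holds {p : ℕ} (hp : p.Prime) {n : ℕ} (hpn : p ∣ n) (hn : 1 ≤ n) {k : Type} [Field k] [CharP k p]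
    (g : Y ⟶ Spec (.of k)) (hB : IsBase Y g) (M : MarkedIdeal Y) (hM : IsDatum n M) (hNC : IsNCHypStageLow p n ⟨Y, M.ideal⟩) :
    ∃ t : CentreSeq Y, WeakResolution t M := by
  haveI := hB.locallyOfFiniteType
  haveI := hB.quasiCompact
  haveI : IsLocallyNoetherian Y := LocallyOfFiniteType.isLocallyNoetherian g
  obtain ⟨E, H, hEs, hH, hP⟩ :=
    exists_ncHypShapeLow_of_isNCHypStageLow hp hpn (le_trans hp.two_le (Nat.le_of_dvd hn hpn)) g hB hM hNC
  exact hP.exists_weakResolution hEs hH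

/-- ★★ **THE LOW-RESIDUE CELL IS DECIDED · HOLDS** — `WORNCHypWildLow n` for every `n ≥ 1`: over a field of characteristic `p ∣ n`, a
base `n`-datum whose stage is a LOW-RESIDUE labelled s.n.c. hypersurface-shape stage admits a weak resolution — every face is safe
(T17a/T15), the safe-face round lemma (T17b) transforms the shape, and the new label stays low along Kollár's star phases at EVERY
marking (R22a `low_weightOf_sub_of_starBelowH`).  The FIRST decided cell at the composite markings `n = p·m`; the cell
`WORNCHypWildLow` of the carving `worNCHypWildRest4_iff_low_rest5` is DECIDED · HOLDS; `WORNCHypWildRest5` stays UNDECIDED. [new]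
[cite: Kollar2007, (3.111) Step 3] [cite: CossartPiltant2008, Prop. 4.2 (a)] -/
theorem worNCHypWildLow_holds (n : ℕ) (hn : 1 ≤ n) : WORNCHypWildLow n :=
  fun _ hp _ _ _ _ g hB hpn M hM _ _ _ _ hNC => worLow_holds hp hpn hn g hB M hM hNC

/-- the FAMILY of low-residue cells holds. [new] -/
theorem e1NCHypWildLow_holds : E1NCHypWildLow := worNCHypWildLow_holds

-- the law, fully qualified, binders `n` / `1 ≤ n` only (critic (x2)).
example (n : ℕ) (hn : 1 ≤ n) :
    Summit.ResolutionOfSingularities.ResolutionOfSingularities.Theorems.DeltaCutClasses.WORNCHypWildLow n :=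
  worNCHypWildLow_holds n hn

/-- **at a PRIME level the low-residue cell carries no content**: `p ∣ n` with `n` prime forces `p = n`, the low-residue stage is then a
coprime stage, hence a jet stage (§Class), which the jet binder excludes. [new] -/
theorem worNCHypWildLow_of_prime {n : ℕ} (hn : n.Prime) : WORNCHypWildLow n := by
  intro p hp _ _ _ _ _ _ hpn _ _ _ hJ _ _ hNC
  obtain rfl : p = n := (Nat.prime_dvd_prime_iff_eq hp hn).mp hpn
  exact absurd ⟨rfl, isNCHypStageJet_of_low_self hNC⟩ hJ

/-- ★ **THE REMAINDER IS ITS NEW REMAINDER (exact, `n ≥ 1`)**: `WORNCHypWildRest4 n ⟺ WORNCHypWildRest5 n`. [new] -/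
theorem worNCHypWildRest4_iff_rest5 {n : ℕ} (hn : 1 ≤ n) : WORNCHypWildRest4 n ↔ WORNCHypWildRest5 n := by
  rw [worNCHypWildRest4_iff_low_rest5]
  exact ⟨fun h => h.2, fun h => ⟨worNCHypWildLow_holds n hn, h⟩⟩

/-- ★ per level (`n ≥ 1`), the wild cell reduces to the new remainder: `WORNCHypWild n ⟺ WORNCHypWildRest5 n` (exact). [new] -/
theorem worNCHypWild_iff_rest5 {n : ℕ} (hn : 1 ≤ n) : WORNCHypWild n ↔ WORNCHypWildRest5 n :=
  (worNCHypWild_iff_rest4 n).trans (worNCHypWildRest4_iff_rest5 hn)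

/-- per level: `WORNCHypWildRest5 n → WORNCHyp n` (`n ≥ 1`). [new] -/
theorem worNCHyp_of_wildRest5 {n : ℕ} (hn : 1 ≤ n) (hR : WORNCHypWildRest5 n) : WORNCHyp n :=
  worNCHyp_of_wildRest4 hn ((worNCHypWildRest4_iff_rest5 hn).mpr hR)

/-- families: `E1NCHypWildRest4 ⟺ E1NCHypWildRest5` (exact, hyp-free). [new] -/
theorem e1NCHypWildRest4_iff_rest5 : E1NCHypWildRest4 ↔ E1NCHypWildRest5 :=
  ⟨fun h n hn => (worNCHypWildRest4_iff_rest5 hn).mp (h n hn), fun h n hn => (worNCHypWildRest4_iff_rest5 hn).mpr (h n hn)⟩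

/-- families: `E1NCHypWild ⟺ E1NCHypWildRest5` (exact, hyp-free). [new] -/
theorem e1NCHypWild_iff_rest5 : E1NCHypWild ↔ E1NCHypWildRest5 := e1NCHypWild_iff_rest4.trans e1NCHypWildRest4_iff_rest5

/-- families: `E1NCHypWildRest5 → E1NCHyp`. [new] -/
theorem e1NCHyp_of_wildRest5 (hR : E1NCHypWildRest5) : E1NCHyp := e1NCHyp_of_wildRest4 (e1NCHypWildRest4_iff_rest5.mpr hR)

end Law

/-! ### §Carve — the column's carve with the low-residue cell DISCHARGED -/

section Carve

open SubfieldContactClasses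

/-- exact remainder form: `E1NCHypWildRest5 → E1TopSHeavyOffNC → E1TopSHeavy`. [new] -/
theorem e1TopSHeavy_of_wildRest5_offNC (hR : E1NCHypWildRest5) (hO : E1TopSHeavyOffNC) : E1TopSHeavy :=
  e1TopSHeavy_of_wildRest4_offNC (e1NCHypWildRest4_iff_rest5.mpr hR) hO

/-- edge to the column item (26971): under `SubfieldContactAbs` and `E 5`,
`E1NCHypWildRest5 → E1NCEntryPerpetual → E1TopSFrozenOffNC → E1TopNoAbs`. [new] -/
theorem e1TopNoAbs_of_wildRest5 (hSC : SubfieldContactAbs) (h5 : E 5) (hR : E1NCHypWildRest5) (hE : E1NCEntryPerpetual)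
    (hO : E1TopSFrozenOffNC) : E1TopNoAbs :=
  e1TopNoAbs_of_wildRest4 hSC h5 (e1NCHypWildRest4_iff_rest5.mpr hR) hE hO

/-- edge to the live aside (item 27045): under `E 5`,
`E1NCHypWildRest5 → E1NCEntryPerpetual → E1TopSFrozenOffNC → E1TopGHeavy`. [new] -/
theorem e1TopGHeavy_of_wildRest5 (h5 : E 5) (hR : E1NCHypWildRest5) (hE : E1NCEntryPerpetual) (hO : E1TopSFrozenOffNC) :
    E1TopGHeavy :=
  e1TopGHeavy_of_wildRest4 h5 (e1NCHypWildRest4_iff_rest5.mpr hR) hE hO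

end Carve

end Summit.ResolutionOfSingularities.ResolutionOfSingularities.Theorems.DeltaCutClasses
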